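import Summits.MatrixMultiplication.OmegaCensus.LocalUSPOmegaBound
import Summits.MatrixMultiplication.OmegaCensus.LocalUSPChartBound

/-!
# ω-census, family (b1-U): kernel row for a 17-row local USP of width 8 (eng1 usp v4, 2026-08-20)

HONEST FRAMING (pub-omega census; verbatim): lottery ticket; floor = certified bounds/negative ranges.
Census bookkeeping, not progress on `ω` (tree: `ω < 2.373`).  Sibling of `LocalUSPInstancesK789.lean` (group seat: widths 7–9,
largest puzzles found by the SAT census, where the width-8 local USP row had `s = 16`, value `2.7481`).  The ENG1 seat's exact
search (eng1 `usp4`: composition-ordered forced roots + clique search) met a 17-row local USP of width 8 under the root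
`11122233`; the puzzle below is that witness (symbols `1,2,3` coded `0,1,2`), re-verified from the definition by two independent
checkers before this file was cut.  Same proof shape as the sibling file: `decide` (the local pattern property of the explicit
puzzle) + `decide +kernel` (one integer inequality) + `omega_le_div_of_isLocalUSP` (CKSU 2005 Thm. 37 + Thm. 5.5 through the
Coppersmith–Winograd chart, tree-proved).  Maximality of 17 at width 8 is NOT claimed here.
-/

noncomputable section

open Literature.Computability.AlgebraicComplexity

namespace Summit.MatrixMultiplication.OmegaCensus

/-- Census row (b1-U) `w8_s17`: the local USP `{11122233 33112212 31321212 31231221 31223112 31221123 23213211 22311132 23232111 22131321 21133122 13212123 21112332 12323211 12321312 12123123 12112323}` (17 rows, width 8; pattern set `L ∪ {123}`;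
found by the ENG1 exact search eng1 `usp4` on 2026-08-20 — one row more than the SAT census's `w8_s16`; maximality at width 8 not
claimed) through the CW chart with modulus `m = 23` certifies `ω ≤ 2.7407 = 27407/10000` (integer certificate
`23^240000 ≤ 17^30000·21^219256`, tight in the last digit: the exponent `27406·8` fails; exact value of the row
`3(8 log 23 − log 17)/(8 log 21) = 2.7406687959…`). [cite: CohnKleinbergSzegedyUmans2005, Thm. 37 and §6.3] -/
theorem omega_le_of_localUSP_w8_s17 : omega ℂ ≤ 2.7407 := by
  have h := omega_le_div_of_isLocalUSP (row := ![![0, 0, 0, 1, 1, 1, 2, 2], ![2, 2, 0, 0, 1, 1, 0, 1], ![2, 0, 2, 1, 0, 1, 0, 1], ![2, 0, 1, 2, 0, 1, 1, 0], ![2, 0, 1, 1, 2, 0, 0, 1], ![2, 0, 1, 1, 0, 0, 1, 2], ![1, 2, 1, 0, 2, 1, 0, 0], ![1, 1, 2, 0, 0, 0, 2, 1], ![1, 2, 1, 2, 1, 0, 0, 0], ![1, 1, 0, 2, 0, 2, 1, 0], ![1, 0, 0, 2, 2, 0, 1, 1], ![0, 2, 1, 0, 1, 0, 1, 2], ![1,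 0, 0, 0, 1, 2, 2, 1], ![0, 1, 2, 1, 2, 1, 0, 0], ![0, 1, 2, 1, 0, 2, 0, 1], ![0, 1, 0, 1, 2, 0, 1, 2], ![0, 1, 0, 0, 1, 2, 1, 2]])
    (by unfold localStrongUSPPatterns; decide +kernel) (by norm_num) (by norm_num)
    (m := 23) (by norm_num) (a := 27407) (b := 10000) (by norm_num) (by decide +kernel)
  have e : ((27407 : ℕ) : ℝ) / ((10000 : ℕ) : ℝ) = 2.7407 := by norm_num
  rwa [e] at h

end Summit.MatrixMultiplication.OmegaCensus

end
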